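import Literature.MathematicalPhysics.QuantumFieldTheory.Balaban1983to89.Node00.SmallFieldChiOfRecord
import Literature.MathematicalPhysics.QuantumFieldTheory.Balaban1983to89.B14Eq218Concrete

/-!
# NODE 00 — DEFINER ₇, FILE 4 (₇b-1): the large-field representation (2.18) [III] OF RECORD — the summation index, the
# characteristic functions `χ_k(Ω_k)` with every input pinned, the `𝐓_k exp A_k` data as the EXPLICIT RESIDUAL, and the
# pieces `ρ_k(Z, ·)` of (0.2) [IV]

Seat `pub-ymgap-node00-def-R` (DEFINER ₇).  [III] = [Balaban1988Convergent], [IV] = [Balaban1989LargeFieldI], [I] =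
[Balaban1987RG1].

WHAT THIS FILE IS.  FILE 2 (`Node00.ROperationOfRecord`) carries Bałaban's `R` over a residual `rep : RepOfRecord` — an ARBITRARY
assignment of representation data to densities.  Print's residual is far smaller and has a name: after `k` steps the density is
REPRESENTED ((2.18) [III] p. 257, *«ρ_k(V_k) = Σ_{{Ω_j},{Λ_j}} χ_k(Ω_k) 𝐓_k({Ω_j},{Λ_j}) exp A_k(g_k, U_k)»*, regrouped by the last
large-field region as (0.2) [IV] p. 176 *«ρ(V) = Σ_Z ρ(Z, V)»*), and of its three ingredients two are determined by the record:
* the SUMMATION INDEX — r11's admissible `(Ω, Λ)`-sequences `B14.Eq218Concrete.Seq D k` ((2.1)–(2.3) p. 254–255) over the class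
  `𝐃_j` OF RECORD (`DOfRecord`: unions of the `M R_j`-cubes of the torus cube family of FILE 1, `R_j = RkOfRecord` (2.5), `M` =
  [I]'s basic cube size, an input), `SeqOfRecord`;
* the CHARACTERISTIC FUNCTIONS `χ_k(Ω_k)` — r11's `chi218` with EVERY input pinned exactly as FILE 1's `chiOfRecord` (the [15] map of
  record, `M₁`, the `LM₂R_k`-cubes with their `□^∼`-plaquettes and `□^{∼4}`-enlargements, `ε_k` of record): `chiSeqOfRecord`, which
  on a sequence with `Ω_k = T_η` IS `chiOfRecord` (`chiSeqOfRecord_of_top`, proved);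
* the third — the densities `(𝐓_k({Ω_j},{Λ_j}) exp A_k({Ω_j},{Λ_j}))(V_k)`, i.e. the large-field integral operations `𝐓_k` of
  [III] p. 254 (*«left undefined, only their basic general properties are formulated. Their inductive definition will follow
  successively from the constructions of the subsequent section and forthcoming papers»*) applied to the exponentials of the
  sequence actions (2.23) — is carried as EXPLICIT RESIDUAL DATA `TexpAOfRecord` (one density per run, coupling sequence, step
  and admissible sequence), never as an axiom (node00-def START-HERE l.9324 (b)).
From these: the (2.18) datum of record `repr218OfRecord : Step.Repr218` (r2's shape, last region `Z_k = Λ_kᶜ` (2.3)), the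
ASSEMBLED density `densityOfRepr = Σ_s χ_k(s)·(𝐓_k e^{A_k})(s)` with `holds_densityOfRepr` ((2.18) holds for it, `rfl`), the bare
(2.18)-FORM CLAUSE `Repr218Holds … ρ` for an arbitrary density (the `χ`-and-index part of `Residual₅.S218`; the action formats
(2.23)–(2.44) [III] stay DEFINER ₆'s), and the pieces `pieceOfRecord Z = ρ_k(Z, ·)` of (0.2) [IV] with `sum_pieceOfRecord`
(`Σ_Z ρ_k(Z, ·) = ρ_k`, `Finset.sum_fiberwise`) — the input of the represented TOWER of record on dag-n12-b's carrier
`Node00.LargeFieldTowerShapes` (₇b-2, next file: components, the `Z′ ∕ Z″` split of (0.3) by [IV] p. 177 (i)–(ii), `repOfTower`).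

HONEST SCOPE.  Definitions of record + kernel bookkeeping (`rfl`, `Finset.sum_fiberwise`, `Finset.prod_coe_sort`).  Nothing of
Bałaban's is asserted: NOT that the record's density `ρ_k` IS `densityOfRepr` for some residual datum (that is Theorem 1 [III] ∕
the §2-form clause `S218` of `Node00.Record5`, DEFINER ₆ and the N-cells), no property (2.19)–(2.22) of the `𝐓_k`, no estimate,
no positivity.  `unionsOfCubes` is print's «unions of cubes» for the cube family of FILE 1 (a partition of `T_η` when the side
divides the period — node00-def's numeric side condition, dag-n11-a [DAGN11A-G2-READING-1-CUBESIDE]; total either way).  Counts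
unmoved (typed 28∕28 · discharged 1∕28); nothing continuum ∕ ℝ⁴ ∕ OS ∕ mass-gap ∕ Clay.  No `sorry`, no `axiom`, no `opaque`,
no `instance`, no `notation`.
-/

open MeasureTheory
open scoped BigOperators

namespace Literature.MathematicalPhysics.QuantumFieldTheory.Balaban1983to89.Node00

open T4Continuum B15DeterminingSets B14.Eq213DetSet B14.Eq216Concrete B14.Eq213MaximalDomains B15Eq112TorusCover B14DomainGeom B14.Eq218Concrete

noncomputable section

/-! ## §1  The class `𝐃_j` of record and the (2.18) summation index -/

section DomainClass

variable (P : Params)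

/-- The class of unions of cubes of the `s`-cube partition of `T_η` (index family `cubeIndices P s`, point sets `cubeEnl P s a 0`).
[cite: Balaban1988Convergent, p.254 («Ω_j, Λ_j … unions of big cubes»); Balaban1987RG1, p.257 (class 𝐃_j)] -/
def unionsOfCubes (s : ℕ) : Set (Set (Site P 0)) :=
  {S | ∃ A : Finset (Pt P.d), A ⊆ cubeIndices P s ∧ S = ⋃ a ∈ A, cubeEnl P s a 0}

/-- Membership in `unionsOfCubes`. [cite: Balaban1988Convergent, p.254 (bookkeeping)] -/
theorem mem_unionsOfCubes_iff (s : ℕ) (S : Set (Site P 0)) :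
    S ∈ unionsOfCubes P s ↔ ∃ A : Finset (Pt P.d), A ⊆ cubeIndices P s ∧ S = ⋃ a ∈ A, cubeEnl P s a 0 := Iff.rfl

/-- The empty region is a union of (no) cubes. [cite: Balaban1988Convergent, p.254 (bookkeeping)] -/
theorem empty_mem_unionsOfCubes (s : ℕ) : (∅ : Set (Site P 0)) ∈ unionsOfCubes P s :=
  ⟨∅, Finset.empty_subset _, by simp⟩

end DomainClass

/-- The side, in fine sites, of the `𝐃_j` cubes: *«M R_j-cubes of the lattice T_{L^{−j}}»* = `L^j·M·R_j` fine sites (same convention as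
`cubeSide`: unit length at step `j` = `L^j` fine spacings). [cite: Balaban1988Convergent, (2.1) p.254; Balaban1988Convergent, p.246] -/
def dCubeSide (L M Rj j : ℕ) : ℕ := L ^ j * M * Rj

variable (F : T4Family) (N : ℕ) [NeZero N]

/-- `𝐃_j` OF RECORD along a coupling sequence `g`: unions of `M R_j`-cubes, `R_j = RkOfRecord L r g_j` ((2.5)), `M` = [I]'s basic cube
size (an input). [cite: Balaban1988Convergent, (2.1) p.254] -/
def DOfRecord (ν : Stage7Numerics) (M : ℕ) (g : ℕ → ℝ) (K : ℕ) : ℕ → Set (Set (Site (F.P K) 0)) :=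
  fun j => unionsOfCubes (F.P K) (dCubeSide (F.P K).L M (RkOfRecord (F.P K).L ν.r (g j)) j)

/-- The (2.18) summation index OF RECORD at step `k`: r11's admissible `(Ω, Λ)`-sequences over `𝐃_j` of record.
[cite: Balaban1988Convergent, (2.1)–(2.3) p.254–255, (2.18) p.257] -/
abbrev SeqOfRecord (ν : Stage7Numerics) (M : ℕ) (g : ℕ → ℝ) (K k : ℕ) : Type :=
  Seq (DOfRecord F ν M g K) k

/-! ## §2  The characteristic functions `χ_k(Ω_k)` of record -/

/-- `χ_k(Ω_k)` OF RECORD for a sequence: r11's `chi218` with every input pinned as in `chiOfRecord` (the [15] map of record, `M₁`,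
the `LM₂R_k`-cube family with its `□^∼`-plaquettes and `□^{∼4}` enlargements, `ε_k` of record). [cite: Balaban1988Convergent, (2.17)–(2.18) p.257] -/
def chiSeqOfRecord (ν : Stage7Numerics) (M : ℕ) (g : ℕ → ℝ) (K k : ℕ) (s : SeqOfRecord F ν M g K k) :
    GaugeField (F.P K) k (SU N) → ℝ :=
  chi218 (ι := ↥(cubeIndices (F.P K) (cubeSide (F.P K).L ν.M₂ (RkOfRecord (F.P K).L ν.r (g k)) k)))
    (bgOfRecord (avOfRecord F N K) {U | PlaqSmall (ν.εreg * (F.P K).eta k ^ 2) U}) ν.M₁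
    (fun a => cubeEnl (F.P K) (cubeSide (F.P K).L ν.M₂ (RkOfRecord (F.P K).L ν.r (g k)) k) a 0)
    (fun a => plaqInside (cubeEnl (F.P K) (cubeSide (F.P K).L ν.M₂ (RkOfRecord (F.P K).L ν.r (g k)) k) a 1))
    (fun a => cubeEnl (F.P K) (cubeSide (F.P K).L ν.M₂ (RkOfRecord (F.P K).L ν.r (g k)) k) a 4)
    (epsOfRecord ν g k) k s

/-- On a sequence whose last domain `Ω_k` is the whole lattice, `χ_k(Ω_k)` of record is the small-field function `chiOfRecord` of the
record (the product over ALL `LM₂R_k`-cubes). [cite: Balaban1988Convergent, (2.17)–(2.18) p.257 (bookkeeping)] -/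
theorem chiSeqOfRecord_of_top (ν : Stage7Numerics) (M : ℕ) (g : ℕ → ℝ) (K k : ℕ) (s : SeqOfRecord F ν M g K k)
    (hs : s.Ω k = Set.univ) : chiSeqOfRecord F N ν M g K k s = chiOfRecord F N ν g K k := by
  funext V
  rw [chiSeqOfRecord, chi218_apply, chiOfRecord, B14.Eq216Concrete.chi217]
  rw [hs, cubesIn_univ]
  exact Finset.prod_coe_sort (cubeIndices (F.P K) (cubeSide (F.P K).L ν.M₂ (RkOfRecord (F.P K).L ν.r (g k)) k))
    (fun a => chiSmall (plaqInside (cubeEnl (F.P K) (cubeSide (F.P K).L ν.M₂ (RkOfRecord (F.P K).L ν.r (g k)) k) a 1))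
      (epsOfRecord ν g k * (F.P K).eta k ^ 2)
      (B14.Eq216Concrete.ukBox (bgOfRecord (avOfRecord F N K) {U | PlaqSmall (ν.εreg * (F.P K).eta k ^ 2) U}) ν.M₁
        (cubeEnl (F.P K) (cubeSide (F.P K).L ν.M₂ (RkOfRecord (F.P K).L ν.r (g k)) k) a 4) k V))

/-! ## §3  The residual `𝐓_k exp A_k` data, the (2.18) datum of record, the assembled density and its pieces (0.2) -/

/-- RESIDUAL DATA of the large-field representation: the densities `(𝐓_k({Ω_j},{Λ_j}) exp A_k({Ω_j},{Λ_j}))(V_k)` of (2.18), one per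
admissible sequence — the 𝐓-operations of [III] p.254 («left undefined, only their basic general properties are formulated») and the
sequence actions (2.23) carried as explicit DATA, never as an axiom. [cite: Balaban1988Convergent, (2.18) p.257, p.254] -/
abbrev TexpAOfRecord (ν : Stage7Numerics) (M : ℕ) : Type :=
  (p : B12.RunParams) → (g : ℕ → ℝ) → (k : ℕ) → SeqOfRecord F ν M g p.K k → Density (F.P p.K) k (SU N)

/-- The (2.18) representation datum OF RECORD at run `p`, couplings `g`, step `k`: index = sequences of record, `χ` = `chiSeqOfRecord`,
`𝐓exp A` = the residual data, last large-field region `Z_k = Λ_kᶜ`. [cite: Balaban1988Convergent, (2.18) p.257, (2.3) p.255] -/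
def repr218OfRecord (ν : Stage7Numerics) (M : ℕ) (texpA : TexpAOfRecord F N ν M) (p : B12.RunParams) (g : ℕ → ℝ) (k : ℕ) :
    Step.Repr218 (F.P p.K) (SU N) k where
  Adm := SeqOfRecord F ν M g p.K k
  Zs := Set (Site (F.P p.K) 0)
  finZs := Fintype.ofFinite _
  decZs := Classical.decEq _
  χ := chiSeqOfRecord F N ν M g p.K k
  TexpA := texpA p g k
  lastZ s := (s.Λ k)ᶜ

/-- The density ASSEMBLED from the representation of record: `Σ_s χ_k(s)(V) · (𝐓_k(s) exp A_k(s))(V)` — the right side of (2.18).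
[cite: Balaban1988Convergent, (2.18) p.257] -/
def densityOfRepr (ν : Stage7Numerics) (M : ℕ) (texpA : TexpAOfRecord F N ν M) (p : B12.RunParams) (g : ℕ → ℝ) (k : ℕ) :
    Density (F.P p.K) k (SU N) :=
  fun V => ∑ s : SeqOfRecord F ν M g p.K k, chiSeqOfRecord F N ν M g p.K k s V * texpA p g k s V

/-- The assembled density satisfies (2.18) for the datum of record (by construction). [cite: Balaban1988Convergent, (2.18) p.257 (bookkeeping)] -/
theorem holds_densityOfRepr (ν : Stage7Numerics) (M : ℕ) (texpA : TexpAOfRecord F N ν M) (p : B12.RunParams) (g : ℕ → ℝ) (k : ℕ) :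
    (repr218OfRecord F N ν M texpA p g k).Holds (densityOfRepr F N ν M texpA p g k) := by
  intro V
  unfold repr218OfRecord densityOfRepr
  rfl

/-- The bare (2.18)-FORM CLAUSE for a density `ρ` at run `p`, couplings `g`, step `k`, GIVEN the residual `𝐓e^A` data:
`ρ(V) = Σ_s χ_k(s)(V)·(𝐓_k e^{A_k})(s)(V)` for every `V` (`Step.Repr218.Holds` of the datum of record) — the index-and-`χ` part of
`Residual₅.S218`; the action formats (2.23)–(2.44) [III] constraining the data are DEFINER ₆'s. [cite: Balaban1988Convergent, (2.18) p.257] -/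
def Repr218Holds (ν : Stage7Numerics) (M : ℕ) (texpA : TexpAOfRecord F N ν M) (p : B12.RunParams) (g : ℕ → ℝ) (k : ℕ)
    (ρ : Density (F.P p.K) k (SU N)) : Prop :=
  (repr218OfRecord F N ν M texpA p g k).Holds ρ

/-- A density has the (2.18) form of record iff it IS the assembled density. [cite: Balaban1988Convergent, (2.18) p.257 (bookkeeping)] -/
theorem repr218Holds_iff (ν : Stage7Numerics) (M : ℕ) (texpA : TexpAOfRecord F N ν M) (p : B12.RunParams) (g : ℕ → ℝ) (k : ℕ)
    (ρ : Density (F.P p.K) k (SU N)) :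
    Repr218Holds F N ν M texpA p g k ρ ↔ ρ = densityOfRepr F N ν M texpA p g k := by
  constructor
  · intro h; funext V; exact (h V).trans (holds_densityOfRepr F N ν M texpA p g k V).symm
  · rintro rfl; exact holds_densityOfRepr F N ν M texpA p g k

open Classical in
/-- The piece with last large-field region `Z` of the density of record: `ρ_k(Z, V) = Σ_{s : Λ_k(s)ᶜ = Z} χ_k(s)(V)(𝐓_k(s)e^{A_k(s)})(V)` —
(0.2) [IV] read on (2.18) [III] (`Step.Repr218.piece` for the datum of record). [cite: Balaban1989LargeFieldI, (0.2) p.176] -/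
def pieceOfRecord (ν : Stage7Numerics) (M : ℕ) (texpA : TexpAOfRecord F N ν M) (p : B12.RunParams) (g : ℕ → ℝ) (k : ℕ)
    (Z : Set (Site (F.P p.K) 0)) : Density (F.P p.K) k (SU N) :=
  fun V => ∑ s ∈ Finset.univ.filter (fun s : SeqOfRecord F ν M g p.K k => (s.Λ k)ᶜ = Z),
    chiSeqOfRecord F N ν M g p.K k s V * texpA p g k s V

open Classical in
/-- (0.2) [IV] for the record: `Σ_Z ρ_k(Z, V) = ρ_k(V)` for the assembled density (`Finset.sum_fiberwise`).
[cite: Balaban1989LargeFieldI, (0.2) p.176 (bookkeeping)] -/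
theorem sum_pieceOfRecord (ν : Stage7Numerics) (M : ℕ) (texpA : TexpAOfRecord F N ν M) (p : B12.RunParams) (g : ℕ → ℝ) (k : ℕ)
    (V : GaugeField (F.P p.K) k (SU N)) :
    ∑ Z : Set (Site (F.P p.K) 0), pieceOfRecord F N ν M texpA p g k Z V = densityOfRepr F N ν M texpA p g k V := by
  simp only [pieceOfRecord, densityOfRepr]
  exact Finset.sum_fiberwise Finset.univ (fun s : SeqOfRecord F ν M g p.K k => (s.Λ k)ᶜ)
    (fun s => chiSeqOfRecord F N ν M g p.K k s V * texpA p g k s V)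

end

end Literature.MathematicalPhysics.QuantumFieldTheory.Balaban1983to89.Node00
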